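import Literature.NumberTheory.LFunctions.Zhang2022.KnifeEdgeLenZDegreeK0Short
import HarnessLib

/-!
# Zhang (2022) §8: the JET CONVERSIONS between the rows' exact shift constants (`β_jΛ`, `Λ(β_{j+1}+β_{j+2})`,
# `Λ²β_{j+1}β_{j+2}`, `Λ = log P`) and DISPLAY #5's integers (`iπb_j`, `iπ(b′+b″) = iπ·bS j`, `−π²b′b″ = −π²·bN j`):
# each differs by `O(c′α𝓛) = O(𝓛⁻⁸)` relatively ((2.13): `β_j = ijα(1 + κ_jc′α𝓛)`, `|κ_j| ≤ 5`, `α𝓛⁹ = π`)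

Topic `Literature/NumberTheory/LFunctions/Zhang2022` (Landau–Siegel audit tree; verdict-neutral). Y. Zhang, *Discrete mean
estimates and the Landau–Siegel zero*, arXiv:2211.02515v1 (2022) [Zhang2022LandauSiegel] — **an unrefereed manuscript
under adjudication; no claim about its Theorems 1–2 or about Landau–Siegel zeros.** Cell landau-siegel §D, crux K0 =
stmt-Parity-20459 (row (S)), prover ls-knife-K0-p1 g0. The pointwise rows `DipoleRule.psiRow_C2` / `antiRow_C2` carry the
EXACT constants `γ_j = β_jΛ` and (via `massRule_constants`) `Λ(β′+β″)`, `Λ²β′β″`; the row (S) `KnifeEdge.SjProfileRow` is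
stated with `k0jet j` (`iπj`) and `k0mass (bS j) (bN j)` (`iπ(6−j)`, `−π²(j²−6j+11)`). This file quantifies the gap:
`betaJ_mul_ell9` (exact form), `norm_betaJ_mul_ell9_sub_le` (`≤ 15π|c′|·α𝓛`), `norm_jet_sub_k0jet_le`,
`norm_betaSum_mul_sub_le` (`≤ 30π|c′|α𝓛`), `norm_betaProd_mul_add_le` (`≤ π²·6·(10|c′|α𝓛 + 25c′²(α𝓛)²)`), and
`alpha_mul_ell_eq` (`α𝓛 = π𝓛⁻⁸`).

## References
* Y. Zhang, arXiv:2211.02515v1 (2022), §2 (2.10), (2.13); §8 p. 17. [cite: Zhang2022LandauSiegel, §2 (2.13)]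
-/

noncomputable section

open Complex Real

namespace Literature.NumberTheory.LFunctions.Zhang2022.DipoleRule

open Skeleton

/-- `α·𝓛⁹ = π` and `α𝓛 = π𝓛⁻⁸` ((2.6), (2.10)), for `𝓛 ≠ 0`. [cite: Zhang2022LandauSiegel, §2 (2.10)] -/
theorem alpha_mul_ell9_eq {D : ℕ} (hℓ : ell D ≠ 0) : alpha D * ell D ^ 9 = π ∧ alpha D * ell D = π / ell D ^ 8 := by
  have hα : alpha D = π / ell D ^ 9 := by rw [alpha, bigP, Real.log_exp]
  constructor
  · rw [hα]; field_simp
  · rw [hα]; field_simp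

/-- **`β_jΛ = iπj(1 + κ_jc′α𝓛)`** with `κ = −5, 1, −1` for `j = 1, 2, 3` ((2.13), `Λ = 𝓛⁹`, `αΛ = π`).
[cite: Zhang2022LandauSiegel, §2 (2.13)] -/
theorem betaJ_mul_ell9 (c' : ℝ) {D : ℕ} (hℓ : ell D ≠ 0) {j : ℕ} (hj : j ∈ ({1, 2, 3} : Finset ℕ)) :
    ∃ κ : ℝ, |κ| ≤ 5 ∧
      betaJ c' D j * ((ell D ^ 9 : ℝ) : ℂ) = I * π * (j : ℂ) * (((1 + κ * c' * (alpha D * ell D) : ℝ)) : ℂ) := by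
  have h9 := (alpha_mul_ell9_eq hℓ).1
  simp only [Finset.mem_insert, Finset.mem_singleton] at hj
  rcases hj with rfl | rfl | rfl
  · refine ⟨-5, by norm_num, ?_⟩
    rw [betaJ]; simp only [Nat.one_mod, if_true, beta1]
    push_cast
    have : (alpha D : ℂ) * (ell D : ℂ) ^ 9 = π := by exact_mod_cast h9
    linear_combination (I * (1 - 5 * c' * (alpha D * ell D)) : ℂ) * this
  · refine ⟨1, by norm_num, ?_⟩
    rw [betaJ]; simp only [Nat.reduceMod, if_true, beta2, show (2:ℕ) % 3 ≠ 1 by decide, if_false]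
    push_cast
    have : (alpha D : ℂ) * (ell D : ℂ) ^ 9 = π := by exact_mod_cast h9
    linear_combination (2 * I * (1 + c' * (alpha D * ell D)) : ℂ) * this
  · refine ⟨-1, by norm_num, ?_⟩
    rw [betaJ]; simp only [Nat.reduceMod, beta3, show (3:ℕ) % 3 ≠ 1 by decide, show (3:ℕ) % 3 ≠ 2 by decide, if_false]
    push_cast
    have : (alpha D : ℂ) * (ell D : ℂ) ^ 9 = π := by exact_mod_cast h9
    linear_combination (3 * I * (1 - c' * (alpha D * ell D)) : ℂ) * this

/-- **`‖β_jΛ − iπj‖ ≤ 15π|c′|·α𝓛`** for `j = 1,2,3` (`α𝓛 = π𝓛⁻⁸`). [cite: Zhang2022LandauSiegel, §2 (2.13)] -/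
theorem norm_betaJ_mul_ell9_sub_le (c' : ℝ) {D : ℕ} (hℓ : ell D ≠ 0) {j : ℕ} (hj : j ∈ ({1, 2, 3} : Finset ℕ)) :
    ‖betaJ c' D j * ((ell D ^ 9 : ℝ) : ℂ) - I * π * (j : ℂ)‖ ≤ 15 * π * |c'| * (alpha D * ell D) := by
  have hαℓ : 0 ≤ alpha D * ell D := by
    rw [(alpha_mul_ell9_eq hℓ).2]
    exact div_nonneg Real.pi_pos.le (by positivity)
  have hj3 : (j : ℝ) ≤ 3 := by
    simp only [Finset.mem_insert, Finset.mem_singleton] at hj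
    rcases hj with rfl | rfl | rfl <;> norm_num
  obtain ⟨κ, hκ, h⟩ := betaJ_mul_ell9 c' hℓ hj
  rw [h]
  have e : I * π * (j : ℂ) * (((1 + κ * c' * (alpha D * ell D) : ℝ)) : ℂ) - I * π * (j : ℂ)
      = I * π * (j : ℂ) * (((κ * c' * (alpha D * ell D) : ℝ)) : ℂ) := by push_cast; ring
  rw [e, norm_mul, norm_mul, norm_mul, Complex.norm_I, one_mul, Complex.norm_real, Complex.norm_natCast,
    Complex.norm_real, Real.norm_eq_abs, abs_of_pos Real.pi_pos, Real.norm_eq_abs, abs_mul, abs_mul,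
    abs_of_nonneg hαℓ]
  have hπ := Real.pi_pos.le
  calc π * j * (|κ| * |c'| * (alpha D * ell D)) ≤ π * 3 * (5 * |c'| * (alpha D * ell D)) := by gcongr
    _ = 15 * π * |c'| * (alpha D * ell D) := by ring

/-- **The ψ-side jet conversion:** `‖(β_jΛ·u(z) + u′(z)) − 𝔧_j(u;z)‖ ≤ 15π|c′|α𝓛·‖u(z)‖` where
`𝔧_j(u;z) = KnifeEdge.k0jet j u u′ z = u′(z) + iπj·u(z)`. [cite: Zhang2022LandauSiegel, §2 (2.13); §8 Lemma 8.2] -/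
theorem norm_jet_sub_k0jet_le (c' : ℝ) {D : ℕ} (hℓ : ell D ≠ 0) {j : ℕ} (hj : j ∈ ({1, 2, 3} : Finset ℕ))
    (u u' : ℝ → ℂ) (z : ℝ) :
    ‖(betaJ c' D j * ((ell D ^ 9 : ℝ) : ℂ) * u z + u' z) - KnifeEdge.k0jet j u u' z‖
      ≤ 15 * π * |c'| * (alpha D * ell D) * ‖u z‖ := by
  unfold KnifeEdge.k0jet
  have e : betaJ c' D j * ((ell D ^ 9 : ℝ) : ℂ) * u z + u' z - (u' z + I * π * (j : ℂ) * u z)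
      = (betaJ c' D j * ((ell D ^ 9 : ℝ) : ℂ) - I * π * (j : ℂ)) * u z := by ring
  rw [e, norm_mul]
  exact mul_le_mul_of_nonneg_right (norm_betaJ_mul_ell9_sub_le c' hℓ hj) (norm_nonneg _)

/-- The cyclic pair `(β_{j+1}, β_{j+2})` for `j = 1,2,3` as `(b′, b″) ∈ {(2,3), (3,1), (1,2)}` with `b′ + b″ = bS j`,
`b′b″ = bN j`: exact forms `β_{j+1}Λ = iπb′(1+κ′c′α𝓛)`, `β_{j+2}Λ = iπb″(1+κ″c′α𝓛)`, `|κ′|,|κ″| ≤ 5`.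
[cite: Zhang2022LandauSiegel, §2 (2.13); §8 p. 17 (`β₄ = β₁, β₅ = β₂`)] -/
theorem betaPair_mul_ell9 (c' : ℝ) {D : ℕ} (hℓ : ell D ≠ 0) {j : ℕ} (hj : j ∈ ({1, 2, 3} : Finset ℕ)) :
    ∃ b₁ b₂ κ₁ κ₂ : ℝ, b₁ + b₂ = Repair.bS j ∧ b₁ * b₂ = Repair.bN j ∧ 0 ≤ b₁ ∧ b₁ ≤ 3 ∧ 0 ≤ b₂ ∧ b₂ ≤ 3 ∧
      |κ₁| ≤ 5 ∧ |κ₂| ≤ 5 ∧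
      betaJ c' D (j + 1) * ((ell D ^ 9 : ℝ) : ℂ) = I * π * (b₁ : ℂ) * (((1 + κ₁ * c' * (alpha D * ell D) : ℝ)) : ℂ) ∧
      betaJ c' D (j + 2) * ((ell D ^ 9 : ℝ) : ℂ) = I * π * (b₂ : ℂ) * (((1 + κ₂ * c' * (alpha D * ell D) : ℝ)) : ℂ) := by
  have h9 := (alpha_mul_ell9_eq hℓ).1
  have hC : (alpha D : ℂ) * (ell D : ℂ) ^ 9 = π := by exact_mod_cast h9
  have e1 : beta1 c' D * ((ell D ^ 9 : ℝ) : ℂ) = I * π * (1 : ℝ) * (((1 + (-5) * c' * (alpha D * ell D) : ℝ)) : ℂ) := by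
    rw [beta1]; push_cast; linear_combination (I * (1 - 5 * c' * (alpha D * ell D)) : ℂ) * hC
  have e2 : beta2 c' D * ((ell D ^ 9 : ℝ) : ℂ) = I * π * (2 : ℝ) * (((1 + 1 * c' * (alpha D * ell D) : ℝ)) : ℂ) := by
    rw [beta2]; push_cast; linear_combination (2 * I * (1 + c' * (alpha D * ell D)) : ℂ) * hC
  have e3 : beta3 c' D * ((ell D ^ 9 : ℝ) : ℂ) = I * π * (3 : ℝ) * (((1 + (-1) * c' * (alpha D * ell D) : ℝ)) : ℂ) := by
    rw [beta3]; push_cast; linear_combination (3 * I * (1 - c' * (alpha D * ell D)) : ℂ) * hC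
  simp only [Finset.mem_insert, Finset.mem_singleton] at hj
  rcases hj with rfl | rfl | rfl
  · refine ⟨2, 3, 1, -1, by rw [Repair.bS_one]; norm_num, by rw [Repair.bN_one]; norm_num, by norm_num, by norm_num,
      by norm_num, by norm_num, by norm_num, by norm_num, ?_, ?_⟩
    · rw [betaJ]; simp only [beta2, show (2:ℕ) % 3 ≠ 1 by decide, if_false, if_true]; exact_mod_cast e2
    · rw [betaJ]; simp only [show (3:ℕ) % 3 ≠ 1 by decide, show (3:ℕ) % 3 ≠ 2 by decide, if_false]
      exact_mod_cast e3
  · refine ⟨3, 1, -1, -5, by rw [Repair.bS_two]; norm_num, by rw [Repair.bN_two]; norm_num, by norm_num, by norm_num,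
      by norm_num, by norm_num, by norm_num, by norm_num, ?_, ?_⟩
    · rw [betaJ]; simp only [show (3:ℕ) % 3 ≠ 1 by decide, show (3:ℕ) % 3 ≠ 2 by decide, if_false]
      exact_mod_cast e3
    · rw [betaJ]; simp only [if_true]; exact_mod_cast e1
  · refine ⟨1, 2, -5, 1, by rw [Repair.bS_three]; norm_num, by rw [Repair.bN_three]; norm_num, by norm_num, by norm_num,
      by norm_num, by norm_num, by norm_num, by norm_num, ?_, ?_⟩
    · rw [betaJ]; simp only [if_true]; exact_mod_cast e1
    · rw [betaJ]; simp only [show (5:ℕ) % 3 ≠ 1 by decide, if_false, if_true]; exact_mod_cast e2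

/-- **The anti-side sum conversion:** `‖Λ(β_{j+1} + β_{j+2}) − iπ·bS j‖ ≤ 30π|c′|·α𝓛`. [cite: Zhang2022LandauSiegel, §2 (2.13)] -/
theorem norm_betaSum_mul_sub_le (c' : ℝ) {D : ℕ} (hℓ : ell D ≠ 0) {j : ℕ} (hj : j ∈ ({1, 2, 3} : Finset ℕ)) :
    ‖(betaJ c' D (j + 1) + betaJ c' D (j + 2)) * ((ell D ^ 9 : ℝ) : ℂ) - I * π * ((Repair.bS j : ℝ) : ℂ)‖
      ≤ 30 * π * |c'| * (alpha D * ell D) := by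
  have hαℓ : 0 ≤ alpha D * ell D := by
    rw [(alpha_mul_ell9_eq hℓ).2]; exact div_nonneg Real.pi_pos.le (by positivity)
  obtain ⟨b₁, b₂, κ₁, κ₂, hS, -, hb1, hb1', hb2, hb2', hκ1, hκ2, e1, e2⟩ := betaPair_mul_ell9 c' hℓ hj
  rw [add_mul, e1, e2, ← hS]
  have e : I * π * (b₁ : ℂ) * (((1 + κ₁ * c' * (alpha D * ell D) : ℝ)) : ℂ)
      + I * π * (b₂ : ℂ) * (((1 + κ₂ * c' * (alpha D * ell D) : ℝ)) : ℂ) - I * π * (((b₁ + b₂ : ℝ)) : ℂ)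
      = I * π * ((((b₁ * κ₁ + b₂ * κ₂) * c' * (alpha D * ell D) : ℝ)) : ℂ) := by push_cast; ring
  rw [e, norm_mul, norm_mul, Complex.norm_I, one_mul, Complex.norm_real, Real.norm_eq_abs, abs_of_pos Real.pi_pos,
    Complex.norm_real, Real.norm_eq_abs, abs_mul, abs_mul, abs_of_nonneg hαℓ]
  have hsum : |b₁ * κ₁ + b₂ * κ₂| ≤ 30 := by
    calc |b₁ * κ₁ + b₂ * κ₂| ≤ |b₁ * κ₁| + |b₂ * κ₂| := abs_add_le _ _
      _ = b₁ * |κ₁| + b₂ * |κ₂| := by rw [abs_mul, abs_mul, abs_of_nonneg hb1, abs_of_nonneg hb2]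
      _ ≤ 3 * 5 + 3 * 5 := by gcongr
      _ = 30 := by norm_num
  calc π * (|b₁ * κ₁ + b₂ * κ₂| * |c'| * (alpha D * ell D)) ≤ π * (30 * |c'| * (alpha D * ell D)) := by
        gcongr
    _ = 30 * π * |c'| * (alpha D * ell D) := by ring

/-- **The anti-side product conversion:** `‖Λ²β_{j+1}β_{j+2} + π²·bN j‖ ≤ 9π²(10|c′|α𝓛 + 25c′²(α𝓛)²)`.
[cite: Zhang2022LandauSiegel, §2 (2.13)] -/
theorem norm_betaProd_mul_add_le (c' : ℝ) {D : ℕ} (hℓ : ell D ≠ 0) {j : ℕ} (hj : j ∈ ({1, 2, 3} : Finset ℕ)) :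
    ‖betaJ c' D (j + 1) * ((ell D ^ 9 : ℝ) : ℂ) * (betaJ c' D (j + 2) * ((ell D ^ 9 : ℝ) : ℂ))
        + (π : ℂ) ^ 2 * ((Repair.bN j : ℝ) : ℂ)‖
      ≤ 9 * π ^ 2 * (10 * |c'| * (alpha D * ell D) + 25 * c' ^ 2 * (alpha D * ell D) ^ 2) := by
  have hαℓ : 0 ≤ alpha D * ell D := by
    rw [(alpha_mul_ell9_eq hℓ).2]; exact div_nonneg Real.pi_pos.le (by positivity)
  obtain ⟨b₁, b₂, κ₁, κ₂, -, hN, hb1, hb1', hb2, hb2', hκ1, hκ2, e1, e2⟩ := betaPair_mul_ell9 c' hℓ hj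
  rw [e1, e2, ← hN]
  set ε : ℝ := c' * (alpha D * ell D) with hε
  clear_value ε
  have e : I * π * (b₁ : ℂ) * (((1 + κ₁ * ε : ℝ)) : ℂ)
        * (I * π * (b₂ : ℂ) * (((1 + κ₂ * ε : ℝ)) : ℂ)) + (π : ℂ) ^ 2 * (((b₁ * b₂ : ℝ)) : ℂ)
      = -(π : ℂ) ^ 2 * ((((b₁ * b₂) * ((κ₁ + κ₂) * ε + κ₁ * κ₂ * ε ^ 2) : ℝ)) : ℂ) := by
    push_cast
    have hI : I * I = -1 := Complex.I_mul_I
    linear_combination (π ^ 2 * b₁ * b₂ * (1 + κ₁ * ε) * (1 + κ₂ * ε) : ℂ) * hI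
  have e1' : (((1 + κ₁ * c' * (alpha D * ell D) : ℝ)) : ℂ) = (((1 + κ₁ * ε : ℝ)) : ℂ) := by rw [hε]; push_cast; ring
  have e2' : (((1 + κ₂ * c' * (alpha D * ell D) : ℝ)) : ℂ) = (((1 + κ₂ * ε : ℝ)) : ℂ) := by rw [hε]; push_cast; ring
  rw [e1', e2']
  rw [e, norm_mul, norm_neg, norm_pow, Complex.norm_real, Real.norm_eq_abs, abs_of_pos Real.pi_pos,
    Complex.norm_real, Real.norm_eq_abs]
  have hb : 0 ≤ b₁ * b₂ := mul_nonneg hb1 hb2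
  have hb9 : b₁ * b₂ ≤ 9 := by nlinarith
  have hεabs : |ε| = |c'| * (alpha D * ell D) := by rw [hε, abs_mul, abs_of_nonneg hαℓ]
  have hκs : |κ₁ + κ₂| ≤ 10 := (abs_add_le _ _).trans (by linarith)
  have hκp : |κ₁ * κ₂| ≤ 25 := by
    rw [abs_mul]; nlinarith [abs_nonneg κ₁, abs_nonneg κ₂]
  have h1 : |(κ₁ + κ₂) * ε + κ₁ * κ₂ * ε ^ 2| ≤ 10 * |c'| * (alpha D * ell D) + 25 * c' ^ 2 * (alpha D * ell D) ^ 2 := by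
    calc |(κ₁ + κ₂) * ε + κ₁ * κ₂ * ε ^ 2| ≤ |(κ₁ + κ₂) * ε| + |κ₁ * κ₂ * ε ^ 2| := abs_add_le _ _
      _ = |κ₁ + κ₂| * |ε| + |κ₁ * κ₂| * ε ^ 2 := by
          rw [abs_mul (κ₁ + κ₂) ε, abs_mul (κ₁ * κ₂) (ε ^ 2), abs_of_nonneg (sq_nonneg ε)]
      _ ≤ 10 * |ε| + 25 * ε ^ 2 := by gcongr
      _ = 10 * |c'| * (alpha D * ell D) + 25 * c' ^ 2 * (alpha D * ell D) ^ 2 := by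
          rw [hεabs, hε]; ring
  rw [abs_mul, abs_of_nonneg hb]
  calc π ^ 2 * (b₁ * b₂ * |(κ₁ + κ₂) * ε + κ₁ * κ₂ * ε ^ 2|)
      ≤ π ^ 2 * (9 * (10 * |c'| * (alpha D * ell D) + 25 * c' ^ 2 * (alpha D * ell D) ^ 2)) :=
        mul_le_mul_of_nonneg_left (mul_le_mul hb9 h1 (abs_nonneg _) (by norm_num)) (sq_nonneg π)
    _ = 9 * π ^ 2 * (10 * |c'| * (alpha D * ell D) + 25 * c' ^ 2 * (alpha D * ell D) ^ 2) := by ring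

end Literature.NumberTheory.LFunctions.Zhang2022.DipoleRule

end
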